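import Summits.Schanuel.Schanuel.Theorems.ZilberEacComplexGraphEscapeTop
import HarnessLib

/-!
# EC by escape with polynomial top coefficients: EC vocabulary and a model system

Companion to `ZilberEacComplexGraphEscapeTop.lean` (Theorem E_D^top: Exponential-Algebraic Closedness for
`V = {x_{s+1} = g(x'), yⱼ = Tⱼ(x') y_{s+1}^{κⱼ} + Σ_{i<κⱼ} A_{j,i}(x') y_{s+1}^i}`, `deg g ≥ 2`,
`g_D(κ) ≠ 0`, `(Tⱼ)_{deg Tⱼ}(κ) ≠ 0`; first open rung `dim π₁(V) = n - 1`, Mantova–Masser, PLMS 129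
(2024), §1 p. 5):

* `graphEscapeTop_inter_expGraph_nonempty` — the statement in the vocabulary of
  `Literature.NumberTheory.Transcendental.expGraph`;
* `movingTop_model_system_solvable` — `∃ z w, e^z = z e^{z²+w²} + 1 ∧ e^w = w e^{z²+w²} + 1`, i.e. the
  3-fold `{x₃ = x₁² + x₂², y₁ = x₁y₃ + 1, y₂ = x₂y₃ + 1}` (fibres `y₁ = x₁y₃ + …` with NON-constant top
  coefficient — the shape this packet's census listed as open) meets the graph of `exp`.

HONEST FRAMING: explicit members of the open cell EC(3,2); modest sub-rung of EAC; nothing here bears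
on Schanuel's conjecture, and EC(3,2) itself stays open.
-/

noncomputable section

open Complex MvPolynomial Metric Set Filter Topology

set_option linter.dupNamespace false

namespace Summit.Schanuel.Schanuel.Theorems

/-- **The escape varieties with polynomial top coefficients meet the graph of exponentiation** (EC
vocabulary): with `n = s + 1`, the subvariety
`V = {x_{s+1} = g(x'), yⱼ = Tⱼ(x') y_{s+1}^{κⱼ} + Σ_{i<κⱼ} A_{j,i}(x') y_{s+1}^i}` of `ℂⁿ × ℂⁿ` contains a
point of `Literature.NumberTheory.Transcendental.expGraph ℂ n` whenever `deg g ≥ 2`, `g_D(κ) ≠ 0` and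
`(Tⱼ)_{deg Tⱼ}(κ) ≠ 0`. [cite: MantovaMasser2023, §1 p.5 (the open case dim π(V) = 2 in ℂ³×ℂˣ³)] -/
theorem graphEscapeTop_inter_expGraph_nonempty {s : ℕ} (g : MvPolynomial (Fin s) ℂ)
    (hD : 2 ≤ g.totalDegree) (κ : Fin s → ℕ)
    (hα : eval (fun j => (κ j : ℂ)) (homogeneousComponent g.totalDegree g) ≠ 0)
    (T : Fin s → MvPolynomial (Fin s) ℂ)
    (hT : ∀ j, eval (fun j => (κ j : ℂ)) (homogeneousComponent (T j).totalDegree (T j)) ≠ 0)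
    (A : Fin s → ℕ → MvPolynomial (Fin s) ℂ) :
    ({z : Fin (s + 1) ⊕ Fin (s + 1) → ℂ |
        z (Sum.inl (Fin.last s)) = eval (fun j => z (Sum.inl (Fin.castSucc j))) g ∧
        ∀ j : Fin s, z (Sum.inr (Fin.castSucc j)) =
          eval (fun l => z (Sum.inl (Fin.castSucc l))) (T j) * z (Sum.inr (Fin.last s)) ^ (κ j) +
            ∑ i ∈ Finset.range (κ j), eval (fun l => z (Sum.inl (Fin.castSucc l))) (A j i) *
              z (Sum.inr (Fin.last s)) ^ i} ∩
      Literature.NumberTheory.Transcendental.expGraph ℂ (s + 1)).Nonempty := by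
  obtain ⟨x, hx⟩ := exists_expPoint_graphEscape_top g hD κ hα T hT A
  set X : Fin (s + 1) → ℂ := Fin.snoc x (eval x g) with hX
  refine ⟨Sum.elim X fun i => exp (X i), ⟨?_, fun j => ?_⟩, fun i => ?_⟩
  · simp only [Sum.elim_inl, hX, Fin.snoc_last, Fin.snoc_castSucc]
  · simp only [Sum.elim_inl, Sum.elim_inr, hX, Fin.snoc_castSucc, Fin.snoc_last]
    exact hx j
  · simp [Literature.ModelTheory.ExponentialFields.ExponentialRing.complex_exp_eq]

/-- **A model system with moving top coefficients is solvable**: there are `z, w ∈ ℂ` with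
`e^z = z e^{z²+w²} + 1` and `e^w = w e^{z²+w²} + 1`, i.e. the 3-fold
`V = {x₃ = x₁² + x₂², y₁ = x₁y₃ + 1, y₂ = x₂y₃ + 1} ⊆ ℂ³ × ℂˣ³` (additive projection the paraboloid
`x₃ = x₁² + x₂²`, `dim π₁ V = 2`: the open case of Mantova–Masser 2024 §1 p. 5; fibres with
NON-constant top `y₃`-coefficient `Tⱼ = xⱼ`) meets the graph of `exp`. Theorem E_D^top with
`κ = (1,1)`, `g₂(κ) = 2`, `(Tⱼ)₁(κ) = 1`. New.
[cite: MantovaMasser2023, §1 p.5 (the open case dim π(V) = 2 in ℂ³×ℂˣ³)] -/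
theorem movingTop_model_system_solvable :
    ∃ z w : ℂ, exp z = z * exp (z ^ 2 + w ^ 2) + 1 ∧ exp w = w * exp (z ^ 2 + w ^ 2) + 1 := by
  set g : MvPolynomial (Fin 2) ℂ := X 0 ^ 2 + X 1 ^ 2 with hg
  have hhom : g.IsHomogeneous 2 := (isHomogeneous_X_pow 0 2).add (isHomogeneous_X_pow 1 2)
  have heval : ∀ x : Fin 2 → ℂ, eval x g = x 0 ^ 2 + x 1 ^ 2 := fun x => by
    simp [hg, map_add, map_pow, eval_X]
  have hg0 : g ≠ 0 := by
    intro h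
    have := heval ![1, 0]
    rw [h, map_zero] at this
    norm_num at this
  have hdeg : g.totalDegree = 2 := hhom.totalDegree hg0
  set κ : Fin 2 → ℕ := ![1, 1] with hκdef
  have hα : eval (fun j => (κ j : ℂ)) (homogeneousComponent g.totalDegree g) ≠ 0 := by
    rw [hdeg, homogeneousComponent_eq_self hhom, heval]
    simp [hκdef]
  set T : Fin 2 → MvPolynomial (Fin 2) ℂ := ![X 0, X 1] with hTdef
  have hT0 : T 0 = X 0 := by simp [hTdef]
  have hT1 : T 1 = X 1 := by simp [hTdef]
  have hT : ∀ j, eval (fun j => (κ j : ℂ)) (homogeneousComponent (T j).totalDegree (T j)) ≠ 0 := by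
    refine Fin.forall_fin_two.mpr ⟨?_, ?_⟩
    · rw [hT0, totalDegree_X, homogeneousComponent_eq_self (isHomogeneous_X ℂ 0), eval_X]
      simp [hκdef]
    · rw [hT1, totalDegree_X, homogeneousComponent_eq_self (isHomogeneous_X ℂ 1), eval_X]
      simp [hκdef]
  obtain ⟨x, hx⟩ := exists_expPoint_graphEscape_top g (by rw [hdeg]) κ hα T hT
    (fun _ i => if i = 0 then 1 else 0)
  have hκ0 : κ 0 = 1 := rfl
  have hκ1 : κ 1 = 1 := rfl
  have hsum : ∀ j, ∑ i ∈ Finset.range (κ j),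
      eval x ((fun _ i => if i = 0 then (1 : MvPolynomial (Fin 2) ℂ) else 0) j i) *
        exp (eval x g) ^ i = 1 := by
    intro j
    have hκj : κ j = 1 := by fin_cases j <;> rfl
    rw [hκj]
    simp
  refine ⟨x 0, x 1, ?_, ?_⟩
  · have h := hx 0
    rw [hsum, heval, hT0, eval_X, hκ0, pow_one] at h
    exact h
  · have h := hx 1
    rw [hsum, heval, hT1, eval_X, hκ1, pow_one] at h
    exact h

end Summit.Schanuel.Schanuel.Theorems
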